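import Mathlib
import Summits.Ventures.PercRepro2.XWForm
import Summits.Ventures.PercRepro2.CycleTheorem
import Summits.Ventures.PercRepro2.XWCycleArcs
import Summits.Ventures.PercRepro2.XWCycleFour

/-!
# (XW) on every cycle (PercRepro2, p2 g24)

**`xw_cycle`**: for the `n`-cycle `cycN n` (`V = E = Fin n`), every admissible weight vector and
every placement of four distinct marks `s, y, o, u`, (XW) holds:
`0 ≤ xwBil (cycN n) s y o u p p`, i.e. `P(aλ) + P(Sa)P(Sλ) ≥ P(a)P(λ) + P(S)P(Saλ)` with
`a = {s ↔ u}`, `λ = {y ↔ o}`, `S = {s ↔ y}` (THEOREM of P2-G23-XW.md §8 «(XW) holds on every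
cycle», in the kernel).

Proof.  Sort the four marks (`Finset.orderEmbOfFin`): the mark connectivities of the cycle under
`ω` are those of `C₄` under the arc pattern `arcOpen ω` (`Cycle4.conn_marks_iff`,
`XWCycleArcs.lean`), whose law is the product law of the arc weights `arcProb`
(`Cycle4.prob_arcOpen_preimage`); so the bilinear form transports,
`xwBil (cycN n) s y o u p p = xwBil (cycN 4) k_s k_y k_o k_u (arcProb p) (arcProb p)`
(**`xwBil_transport'`**, the (XW) form of typer-1's `Cycle.Gc_transport'`), and on `C₄` it is
nonnegative for every weight vector by the `C₄` certificate `XWCycleFour.xw_cycle4`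
(all `81` antipodal coefficients of each of the `24` placements, decided).  With the cut-vertex
rows of `XWCutVertex.lean` this gives (XW) on every cactus graph (paper induction on blocks,
P2-G23-XW.md §1 / §8).
-/

namespace Summit.Ventures.PercRepro2

namespace XWCycle

open Cycle Cycle4

/-! ## Transport of the bilinear form across vertex and edge types -/

section Transport

variable {V : Type*} {E : Type*} {V' : Type*} {E' : Type*} [Fintype E] [DecidableEq E]
  [Fintype E'] [DecidableEq E'] {R : Type*} [CommRing R]

/-- **Transport of `B_W` across types**: if `P_q(A) = P_p(Ψ⁻¹ A)` for every event and `Ψ` carries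
`Conn ends` to `Conn ends'` along the vertex map `φ`, then `xwBil` is carried along. -/
theorem xwBil_transport' {q : E → R} {p : E' → R} {ends : E → Sym2 V}
    {ends' : E' → Sym2 V'} {Ψ : Config E' → Config E} {φ : V → V'}
    (hP : ∀ A : Set (Config E), prob q A = prob p (Ψ ⁻¹' A))
    (hH : ∀ ω x z, Conn ends (Ψ ω) x z ↔ Conn ends' ω (φ x) (φ z)) (s y o u : V) :
    xwBil ends s y o u q q = xwBil ends' (φ s) (φ y) (φ o) (φ u) p p := by
  simp only [xwBil, hP, Set.preimage_inter, Cycle.preimage_connEvent' hH]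

end Transport

/-! ## (XW) on every cycle -/

section Theorem

variable {n : ℕ} [NeZero n]
variable {R : Type*} [Field R] [LinearOrder R] [IsStrictOrderedRing R]

/-- The four marks of a cycle instance as a finset. -/
def marks (s y o u : Fin n) : Finset (Fin n) := {s, y, o, u}

omit [NeZero n] in
/-- Four distinct marks are four points. -/
lemma card_marks (s y o u : Fin n) (hsy : s ≠ y) (hso : s ≠ o) (hsu : s ≠ u) (hyo : y ≠ o)
    (hyu : y ≠ u) (hou : o ≠ u) : (marks s y o u).card = 4 := by
  unfold marks
  rw [Finset.card_insert_of_notMem (by simp [hsy, hso, hsu]),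
    Finset.card_insert_of_notMem (by simp [hyo, hyu]),
    Finset.card_insert_of_notMem (by simp [hou]), Finset.card_singleton]

omit [NeZero n] in
/-- Every mark is a sorted mark. -/
lemma exists_orderEmb_eq {M : Finset (Fin n)} (hM : M.card = 4) {x : Fin n} (hx : x ∈ M) :
    ∃ k : Fin 4, M.orderEmbOfFin hM k = x := by
  have h := Finset.range_orderEmbOfFin M hM
  rw [← Finset.mem_coe, ← h] at hx
  exact hx

/-- **(XW) on the `n`-cycle for every admissible weight vector and every placement of the four
distinct marks**: the mark connectivities of the cycle are those of `C₄` with the independent arc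
weights `arcProb` (`conn_marks_iff`, `prob_arcOpen_preimage`), so `xwBil` transports to `C₄`
(`xwBil_transport'`), where it is nonnegative by the `C₄` certificate (`xw_cycle4`). -/
theorem xw_cycle (p : Fin n → R) (hp : IsProbVec p) (s y o u : Fin n) (hsy : s ≠ y) (hso : s ≠ o)
    (hsu : s ≠ u) (hyo : y ≠ o) (hyu : y ≠ u) (hou : o ≠ u) :
    0 ≤ xwBil (cycN n) s y o u p p := by
  have hM := card_marks s y o u hsy hso hsu hyo hyu hou
  set qe := (marks s y o u).orderEmbOfFin hM with hqe
  have hq : StrictMono (⇑qe) := qe.strictMono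
  obtain ⟨ks, hks⟩ := exists_orderEmb_eq hM (x := s) (by simp [marks])
  obtain ⟨ky, hky⟩ := exists_orderEmb_eq hM (x := y) (by simp [marks])
  obtain ⟨ko, hko⟩ := exists_orderEmb_eq hM (x := o) (by simp [marks])
  obtain ⟨ku, hku⟩ := exists_orderEmb_eq hM (x := u) (by simp [marks])
  rw [← hqe] at hks hky hko hku
  have key : xwBil (cycN 4) ks ky ko ku (arcProb (⇑qe) p) (arcProb (⇑qe) p) =
      xwBil (cycN n) s y o u p p := by
    rw [← hks, ← hky, ← hko, ← hku]
    exact xwBil_transport' (fun A => (prob_arcOpen_preimage hq p A).symm)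
      (fun ω x z => (conn_marks_iff hq ω x z).symm) ks ky ko ku
  have dsy : ks ≠ ky := fun h => hsy (by rw [← hks, ← hky, h])
  have dso : ks ≠ ko := fun h => hso (by rw [← hks, ← hko, h])
  have dsu : ks ≠ ku := fun h => hsu (by rw [← hks, ← hku, h])
  have dyo : ky ≠ ko := fun h => hyo (by rw [← hky, ← hko, h])
  have dyu : ky ≠ ku := fun h => hyu (by rw [← hky, ← hku, h])
  have dou : ko ≠ ku := fun h => hou (by rw [← hko, ← hku, h])
  rw [← key]
  exact XWCycleFour.xw_cycle4 (arcProb (⇑qe) p) (isProbVec_arcProb (⇑qe) hp) ks ky ko ku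
    dsy dso dsu dyo dyu dou

end Theorem

end XWCycle

end Summit.Ventures.PercRepro2
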